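import Mathlib
import HarnessLib

/-!
# THE `k`-ARM HOMOGENEITY TEST HAS POWER ONE: IF TWO CODES HAVE DIFFERENT CENTRES,
# `P(Σ_r (Sₖ^r − m̂ₖ)²/V̂ₖ^r ≤ c) → 0` FOR EVERY `c`

HONEST FRAMING: exact (Metropolis-corrected) sampling algorithms for lattice gauge theory;
figures of merit are autocorrelation/cost numbers at stated couplings and volumes; no
continuum-physics claim.

Venture `LatticeQCDFlow` (cell pub-lqcd), topic `Scoring`; FANOUT row 4 (`s0-u1-b`, GEN-33).
NEW WORK of the cell (elementary), no definition, nothing cited as a fact.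

WHY (row 4).  Companion of the calibration theorem `Scoring/KArmHomogeneityCoverage` (null: all codes
share one centre ⇒ `P(Qₖ ≤ c)` tends to the `χ²_{R−1}`-type Gaussian functional).  Here the
alternative: if code `r` prints `Sₖ^r → a_r` in probability and a squared error bar with
`k·V̂ₖ^r → s_r > 0` in probability (each on its own probability space), and two centres differ,
`a_{r₁} ≠ a_{r₂}`, then on the product space of the codes `P(Qₖ ≤ c) → 0` for every `c` — the
inverse-variance homogeneity test rejects a genuine discrepancy with probability tending to one.
Deterministic core: with `δ = |a_{r₁} − a_{r₂}|`, on the event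
`{|S^{r_i} − a_{r_i}| < δ/4, i = 1, 2} ∩ {s_r/2 < k·V̂^r < 2 s_r ∀ r}` one of the two codes is at
distance `≥ δ/4` from the inverse-variance mean, every term of `Q` is non-negative and
`1/V̂^{r_i} ≥ k/(2 max_r s_r)`, so `Qₖ ≥ (δ/4)²·k/(2 s_max)`, which exceeds `c` for large `k`; the
complementary event has probability `→ 0` (finite union bound; the product measure of a
one-coordinate event is the one-code probability).  Mathlib only.

## Content

* `homogeneity_statistic_ge_of_far` (§1) — the deterministic lower bound.
* `pi_measure_preimage_eval` (§2) — `(⊗_r P_r){ω | ω_r ∈ A} = P_r(A)`.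
* **`kArm_homogeneity_power`** (§2) — THE THEOREM (`R` codes on `⊗_r P_r`, any `R`).

NOT CLAIMED: local alternatives / a rate for the power; dependent codes.
-/

open MeasureTheory ProbabilityTheory Filter Topology Finset

namespace Summit.Ventures.LatticeQCDFlow.Scoring

open Set

/-! ## §1 Deterministic lower bound for the homogeneity statistic -/

section Deterministic

variable {R : ℕ}

/-- **If two coordinates are `≥ δ/2` apart (`δ ≥ 0`) and all variances lie in `(0, B]`, the
inverse-variance homogeneity statistic is at least `(δ/4)²/B`.** [ours] -/
theorem homogeneity_statistic_ge_of_far (x v : Fin R → ℝ) {B δ : ℝ} (hB : 0 < B) (hδ : 0 ≤ δ)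
    (hv : ∀ r, 0 < v r) (hvB : ∀ r, v r ≤ B) {r₁ r₂ : Fin R} (hfar : δ / 2 ≤ |x r₁ - x r₂|) :
    (δ / 4) ^ 2 / B ≤ ∑ r, (x r - (∑ j, x j / v j) / (∑ j, (v j)⁻¹)) ^ 2 / v r := by
  set m := (∑ j, x j / v j) / (∑ j, (v j)⁻¹) with hm
  have hterm : ∀ r, 0 ≤ (x r - m) ^ 2 / v r := fun r => div_nonneg (sq_nonneg _) (hv r).le
  -- one of the two far coordinates is at distance ≥ δ/4 from `m`
  have hone : δ / 4 ≤ |x r₁ - m| ∨ δ / 4 ≤ |x r₂ - m| := by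
    by_contra h
    push Not at h
    have h3 : |x r₁ - x r₂| ≤ |x r₁ - m| + |x r₂ - m| := by
      have := abs_sub_le (x r₁) m (x r₂)
      rwa [abs_sub_comm m (x r₂)] at this
    linarith [h.1, h.2]
  have hbound : ∀ r, δ / 4 ≤ |x r - m| → (δ / 4) ^ 2 / B ≤ (x r - m) ^ 2 / v r := by
    intro r hr
    have h1 : (δ / 4) ^ 2 ≤ (x r - m) ^ 2 := by
      rw [← sq_abs (x r - m)]
      exact pow_le_pow_left₀ (by linarith) hr 2
    calc (δ / 4) ^ 2 / B ≤ (x r - m) ^ 2 / B := div_le_div_of_nonneg_right h1 hB.le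
      _ ≤ (x r - m) ^ 2 / v r := div_le_div_of_nonneg_left (sq_nonneg _) (hv r) (hvB r)
  rcases hone with h | h
  · exact (hbound r₁ h).trans (Finset.single_le_sum (f := fun r => (x r - m) ^ 2 / v r)
      (fun r _ => hterm r) (Finset.mem_univ r₁))
  · exact (hbound r₂ h).trans (Finset.single_le_sum (f := fun r => (x r - m) ^ 2 / v r)
      (fun r _ => hterm r) (Finset.mem_univ r₂))

end Deterministic

/-! ## §2 The theorem -/

section Power

variable {R : ℕ} {Ωs : Fin R → Type*} [∀ r, MeasurableSpace (Ωs r)]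
  {Ps : (r : Fin R) → Measure (Ωs r)} [∀ r, IsProbabilityMeasure (Ps r)]

/-- A one-coordinate event has the one-code probability under the product measure. [ours] -/
theorem pi_measure_preimage_eval (r : Fin R) {A : Set (Ωs r)} (hA : MeasurableSet A) :
    Measure.pi Ps ((fun ω : (i : Fin R) → Ωs i => ω r) ⁻¹' A) = Ps r A := by
  rw [← Measure.map_apply (measurable_pi_apply r) hA, (measurePreserving_eval Ps r).map_eq]

/-- **THE `k`-ARM HOMOGENEITY TEST HAS POWER ONE.**  Codes `r : Fin R` on their own probability
spaces print estimates `Sₖ^r → a_r` in probability and squared error bars with `k·V̂ₖ^r → s_r > 0`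
in probability (all measurable); if `a_{r₁} ≠ a_{r₂}` for some pair, then on `⊗_r P_r`, for every
`c`, `P(Σ_r (Sₖ^r − m̂ₖ)²/V̂ₖ^r ≤ c) → 0`. [ours] -/
theorem kArm_homogeneity_power {S V : (r : Fin R) → ℕ → Ωs r → ℝ} {a s : Fin R → ℝ}
    (hs : ∀ r, 0 < s r) (hSm : ∀ r k, Measurable (S r k)) (hVm : ∀ r k, Measurable (V r k))
    (hS : ∀ r, TendstoInMeasure (Ps r) (S r) atTop (fun _ => a r))
    (hV : ∀ r, TendstoInMeasure (Ps r) (fun (k : ℕ) ω => (k : ℝ) * V r k ω) atTop (fun _ => s r))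
    {r₁ r₂ : Fin R} (hne : a r₁ ≠ a r₂) (c : ℝ) :
    Tendsto (fun k : ℕ => (Measure.pi Ps).real {ω : (r : Fin R) → Ωs r |
        ∑ r, (S r k (ω r) - (∑ j, S j k (ω j) / V j k (ω j)) / (∑ j, (V j k (ω j))⁻¹)) ^ 2
          / V r k (ω r) ≤ c}) atTop (𝓝 0) := by
  have hRne : Nonempty (Fin R) := ⟨r₁⟩
  set δ := |a r₁ - a r₂| with hδ
  have hδ0 : 0 < δ := abs_pos.2 (sub_ne_zero.2 hne)
  set smax := Finset.univ.sup' Finset.univ_nonempty s with hsmax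
  have hsmax_ge : ∀ r, s r ≤ smax := fun r => Finset.le_sup' s (Finset.mem_univ r)
  have hsmax0 : 0 < smax := (hs r₁).trans_le (hsmax_ge r₁)
  -- the bad events, each of probability → 0
  set BS : Fin R → ℕ → Set ((r : Fin R) → Ωs r) := fun r k => {ω | δ / 4 ≤ ‖S r k (ω r) - a r‖} with hBS
  set BV : Fin R → ℕ → Set ((r : Fin R) → Ωs r) := fun r k =>
    {ω | s r / 2 ≤ ‖(k : ℝ) * V r k (ω r) - s r‖} with hBV
  have hBS0 : ∀ r, Tendsto (fun k => Measure.pi Ps (BS r k)) atTop (𝓝 0) := by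
    intro r
    have h := (tendstoInMeasure_iff_norm.1 (hS r)) (δ / 4) (by positivity)
    refine h.congr fun k => ?_
    simp only [hBS]
    rw [show {ω : (i : Fin R) → Ωs i | δ / 4 ≤ ‖S r k (ω r) - a r‖}
        = (fun ω : (i : Fin R) → Ωs i => ω r) ⁻¹' {y | δ / 4 ≤ ‖S r k y - a r‖} from rfl,
      pi_measure_preimage_eval r (measurableSet_le measurable_const ((hSm r k).sub_const _).norm)]
  have hBV0 : ∀ r, Tendsto (fun k => Measure.pi Ps (BV r k)) atTop (𝓝 0) := by
    intro r
    have h := (tendstoInMeasure_iff_norm.1 (hV r)) (s r / 2) (half_pos (hs r))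
    refine h.congr fun k => ?_
    simp only [hBV]
    rw [show {ω : (i : Fin R) → Ωs i | s r / 2 ≤ ‖(k : ℝ) * V r k (ω r) - s r‖}
        = (fun ω : (i : Fin R) → Ωs i => ω r) ⁻¹' {y | s r / 2 ≤ ‖(k : ℝ) * V r k y - s r‖} from rfl,
      pi_measure_preimage_eval r (measurableSet_le measurable_const
        (((hVm r k).const_mul _).sub_const _).norm)]
  -- the union of all bad events has probability → 0
  set Bad : ℕ → Set ((r : Fin R) → Ωs r) := fun k => (BS r₁ k ∪ BS r₂ k) ∪ ⋃ r, BV r k with hBad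
  have hBad0 : Tendsto (fun k => Measure.pi Ps (Bad k)) atTop (𝓝 0) := by
    have hU : Tendsto (fun k => Measure.pi Ps (⋃ r, BV r k)) atTop (𝓝 0) := by
      have hle : ∀ k, Measure.pi Ps (⋃ r, BV r k) ≤ ∑ r, Measure.pi Ps (BV r k) :=
        fun k => measure_iUnion_fintype_le _ _
      have hsum : Tendsto (fun k => ∑ r, Measure.pi Ps (BV r k)) atTop (𝓝 0) := by
        have := tendsto_finsetSum (Finset.univ) (fun r _ => hBV0 r)
        simpa using this
      exact tendsto_of_tendsto_of_tendsto_of_le_of_le tendsto_const_nhds hsum (fun _ => bot_le) hle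
    have h12 : Tendsto (fun k => Measure.pi Ps (BS r₁ k ∪ BS r₂ k)) atTop (𝓝 0) := by
      have hle : ∀ k, Measure.pi Ps (BS r₁ k ∪ BS r₂ k) ≤ Measure.pi Ps (BS r₁ k) + Measure.pi Ps (BS r₂ k) :=
        fun k => measure_union_le _ _
      have hsum : Tendsto (fun k => Measure.pi Ps (BS r₁ k) + Measure.pi Ps (BS r₂ k)) atTop (𝓝 0) := by
        simpa using (hBS0 r₁).add (hBS0 r₂)
      exact tendsto_of_tendsto_of_tendsto_of_le_of_le tendsto_const_nhds hsum (fun _ => bot_le) hle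
    have hle : ∀ k, Measure.pi Ps (Bad k) ≤ Measure.pi Ps (BS r₁ k ∪ BS r₂ k) + Measure.pi Ps (⋃ r, BV r k) :=
      fun k => measure_union_le _ _
    have hsum : Tendsto (fun k => Measure.pi Ps (BS r₁ k ∪ BS r₂ k) + Measure.pi Ps (⋃ r, BV r k))
        atTop (𝓝 0) := by simpa using h12.add hU
    exact tendsto_of_tendsto_of_tendsto_of_le_of_le tendsto_const_nhds hsum (fun _ => bot_le) hle
  -- for large `k`, `{Q ≤ c} ⊆ Bad k`
  obtain ⟨K, hK⟩ : ∃ K : ℕ, c < (δ / 4) ^ 2 / (2 * smax) * K := by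
    obtain ⟨K, hK⟩ := exists_nat_gt (c / ((δ / 4) ^ 2 / (2 * smax)))
    refine ⟨K, ?_⟩
    have hpos : 0 < (δ / 4) ^ 2 / (2 * smax) := by positivity
    rwa [div_lt_iff₀ hpos, mul_comm] at hK
  have hsub : ∀ k : ℕ, K ≤ k → 1 ≤ k → {ω : (r : Fin R) → Ωs r |
      ∑ r, (S r k (ω r) - (∑ j, S j k (ω j) / V j k (ω j)) / (∑ j, (V j k (ω j))⁻¹)) ^ 2
        / V r k (ω r) ≤ c} ⊆ Bad k := by
    intro k hKk hk1 ω hω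
    simp only [Set.mem_setOf_eq] at hω
    by_contra hgood
    simp only [hBad, hBS, hBV, Set.mem_union, Set.mem_iUnion, Set.mem_setOf_eq, not_or, not_exists,
      not_le] at hgood
    obtain ⟨⟨hg1, hg2⟩, hgV⟩ := hgood
    have hkpos : (0 : ℝ) < k := by exact_mod_cast hk1
    -- variances in `(0, 2 smax / k]`
    have hVpos : ∀ r, 0 < V r k (ω r) := fun r => by
      have h := hgV r
      rw [Real.norm_eq_abs] at h
      have : s r / 2 < (k : ℝ) * V r k (ω r) := by
        have := abs_lt.1 h; linarith [this.1]
      nlinarith [hs r]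
    have hVle : ∀ r, V r k (ω r) ≤ 2 * smax / k := fun r => by
      have h := hgV r
      rw [Real.norm_eq_abs] at h
      have h2 : (k : ℝ) * V r k (ω r) < 2 * s r := by
        have := abs_lt.1 h; linarith [this.2, hs r]
      rw [le_div_iff₀ hkpos]
      nlinarith [hsmax_ge r]
    -- the two codes are far apart
    have hfar : δ / 2 ≤ |S r₁ k (ω r₁) - S r₂ k (ω r₂)| := by
      rw [Real.norm_eq_abs] at hg1 hg2
      have := abs_sub_abs_le_abs_sub (a r₁ - a r₂) ((a r₁ - S r₁ k (ω r₁)) + (S r₂ k (ω r₂) - a r₂))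
      have h4 : |(a r₁ - S r₁ k (ω r₁)) + (S r₂ k (ω r₂) - a r₂)| < δ / 2 := by
        calc |(a r₁ - S r₁ k (ω r₁)) + (S r₂ k (ω r₂) - a r₂)|
            ≤ |a r₁ - S r₁ k (ω r₁)| + |S r₂ k (ω r₂) - a r₂| := abs_add_le _ _
          _ < δ / 4 + δ / 4 := by rw [abs_sub_comm (a r₁)]; exact add_lt_add hg1 hg2
          _ = δ / 2 := by ring
      have h5 : a r₁ - a r₂ - ((a r₁ - S r₁ k (ω r₁)) + (S r₂ k (ω r₂) - a r₂))
          = S r₁ k (ω r₁) - S r₂ k (ω r₂) := by ring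
      rw [h5] at this
      rw [hδ] at *
      linarith
    have hQ := homogeneity_statistic_ge_of_far (fun r => S r k (ω r)) (fun r => V r k (ω r))
      (B := 2 * smax / k) (by positivity) hδ0.le hVpos hVle hfar
    have hKk' : (K : ℝ) ≤ k := by exact_mod_cast hKk
    have : c < (δ / 4) ^ 2 / (2 * smax / k) := by
      rw [div_div_eq_mul_div]
      calc c < (δ / 4) ^ 2 / (2 * smax) * K := hK
        _ ≤ (δ / 4) ^ 2 / (2 * smax) * k := mul_le_mul_of_nonneg_left hKk' (by positivity)
        _ = (δ / 4) ^ 2 * k / (2 * smax) := by ring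
    linarith
  -- conclude
  have hreal : Tendsto (fun k => (Measure.pi Ps).real (Bad k)) atTop (𝓝 0) := by
    have h := (ENNReal.tendsto_toReal ENNReal.zero_ne_top).comp hBad0
    rw [ENNReal.toReal_zero] at h
    exact h
  refine tendsto_of_tendsto_of_tendsto_of_le_of_le' tendsto_const_nhds hreal
    (Eventually.of_forall fun k => measureReal_nonneg) ?_
  filter_upwards [eventually_ge_atTop K, eventually_ge_atTop 1] with k hKk hk1
  exact measureReal_mono (hsub k hKk hk1) (measure_ne_top _ _)

end Power

end Summit.Ventures.LatticeQCDFlow.Scoring
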